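import Mathlib.Analysis.Matrix.Normed
import Mathlib.Topology.Algebra.Module.FiniteDimension
import Mathlib.RingTheory.Idempotents
import Literature.Analysis.Matrix.EigenvalueBranches
import Literature.LinearAlgebra.Matrix.HermitianAeval
import HarnessLib

/-!
# Smooth spectral projections of a hermitean pencil on a ball of eigenvalue branches

`Literature/Analysis/Matrix/EigenvalueBranches.lean` gives, for hermitean `A₁, …, A_d`, a ball
`B` on which the eigenvalues of `A(ξ) = Σⱼ ξⱼ Aⱼ` are finitely many real-analytic, pairwise
distinct branches `z₁(ξ), …, z_m(ξ)` of constant multiplicities (`EigenBranches hA`). This file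
adds the corresponding **eigenprojections**
`Πᵢ(ξ) = ∏_{k ≠ i} (A(ξ) - z_k(ξ)I)/(zᵢ(ξ) - z_k(ξ))` (the Lagrange polynomials of the distinct
eigenvalues evaluated at `A(ξ)`, `Literature/LinearAlgebra/Matrix/HermitianAeval.lean`), and
proves on `B`: they form a complete family of orthogonal idempotents
(`completeOrthogonalIdempotents_proj`), `A(ξ) = Σᵢ zᵢ(ξ) Πᵢ(ξ)` (`pencil_eq_sum_smul_proj`),
`Πᵢ(ξ) ≠ 0` (`proj_ne_zero`), and their entries are `C^∞` functions of `ξ` on `B`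
(`contDiffOn_proj_apply`: the Lagrange polynomials are explicit products of the smooth matrix
functions `(A(ξ) - z_k(ξ)I)/(zᵢ(ξ) - z_k(ξ))`). This is the second half of the sentence "the
eigenvalues and the corresponding eigenvectors of `A(ξ)` can be chosen as `C^∞` functions on
`B`" of [BrennerThomeeWahlbin1975, Ch. 5 §1, proof of Lemma 1.1], with the eigenvectors
replaced by the (canonical, hence smooth) total eigenprojections, which is all the rescaling
argument (`Literature/Analysis/Fourier/PhaseSymbolRescaling.lean`) consumes; cf. [Kato1966,
Ch. II §1.4 (the eigenprojections `P_h(ϰ)` are holomorphic where the eigenvalues do not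
split), §5.8 Thm 5.16].

## References

* [BrennerThomeeWahlbin1975] P. Brenner, V. Thomée, L. B. Wahlbin, LNM 434 (1975), Ch. 5 §1,
  proofs of Lemmas 1.1–1.2.
* [Kato1966] T. Kato, *Perturbation Theory for Linear Operators* (1966), Ch. II §1.4, §5.8.
-/

noncomputable section

open Polynomial Filter Metric Set
open scoped Topology ContDiff

namespace Literature.Analysis.Matrix

open Literature.LinearAlgebra.Matrix

variable {d N : ℕ} {A : Fin d → Matrix (Fin N) (Fin N) ℂ} {hA : ∀ j, (A j).IsHermitian}

namespace EigenBranches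

variable (E : EigenBranches hA)

/-! ### The labelled spectrum on the ball -/

/-- On the ball every eigenvalue of `A(ξ)` is one of the branch values. [folklore] -/
theorem exists_branch_eq_eigenvalues {ξ : EuclideanSpace ℝ (Fin d)} (hξ : ξ ∈ E.dom)
    (k : Fin N) : ∃ b ∈ (Finset.univ : Finset (Fin E.count)),
      (isHermitian_pencil hA ξ).eigenvalues k = E.branch b ξ := by
  have hroot : (realCharpoly hA ξ).IsRoot ((isHermitian_pencil hA ξ).eigenvalues k) :=
    (isRoot_realCharpoly_iff hA ξ _).2 ⟨k, rfl⟩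
  rw [E.realCharpoly_eq ξ hξ, IsRoot, eval_prod, Finset.prod_eq_zero_iff] at hroot
  obtain ⟨b, -, hb⟩ := hroot
  rw [eval_pow, pow_eq_zero_iff (E.mult_pos b).ne', eval_sub, eval_X, eval_C, sub_eq_zero] at hb
  exact ⟨b, Finset.mem_univ b, hb⟩

/-- The branch values at a point of the ball are pairwise distinct. [folklore] -/
theorem injOn_branch {ξ : EuclideanSpace ℝ (Fin d)} (hξ : ξ ∈ E.dom) :
    Set.InjOn (fun b => E.branch b ξ) (Finset.univ : Finset (Fin E.count)) :=
  (E.injective ξ hξ).injOn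

/-- Each branch value is attained as an eigenvalue `λₖ(ξ)`. [folklore] -/
theorem exists_eigenvalues_eq_branch {ξ : EuclideanSpace ℝ (Fin d)} (hξ : ξ ∈ E.dom)
    (i : Fin E.count) : ∃ k, (isHermitian_pencil hA ξ).eigenvalues k = E.branch i ξ :=
  (isRoot_realCharpoly_iff hA ξ _).1 (E.isRoot_branch hξ i)

/-! ### The eigenprojections -/

/-- **The eigenprojection** `Πᵢ(ξ) = Lᵢ(A(ξ))`, `Lᵢ` the Lagrange basis polynomial of the nodes
`z₁(ξ), …, z_m(ξ)`: `Πᵢ = ∏_{k ≠ i} (A(ξ) - z_k(ξ))/(zᵢ(ξ) - z_k(ξ))`.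
[cite: BrennerThomeeWahlbin1975, Ch. 5 §1, proof of Lemma 1.2] -/
def proj (i : Fin E.count) (ξ : EuclideanSpace ℝ (Fin d)) : Matrix (Fin N) (Fin N) ℂ :=
  aeval (pencil A ξ) (Lagrange.basis Finset.univ (fun b => E.branch b ξ) i)

/-- `A(ξ) Πᵢ(ξ) = zᵢ(ξ) Πᵢ(ξ)` on the ball. [cite: BrennerThomeeWahlbin1975, Ch. 5 §1, proof of Lemma 1.2] -/
theorem pencil_mul_proj {ξ : EuclideanSpace ℝ (Fin d)} (hξ : ξ ∈ E.dom) (i : Fin E.count) :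
    pencil A ξ * E.proj i ξ = ((E.branch i ξ : ℝ) : ℂ) • E.proj i ξ :=
  mul_aeval_basis (isHermitian_pencil hA ξ) (E.injOn_branch hξ)
    (E.exists_branch_eq_eigenvalues hξ) (Finset.mem_univ i)

/-- `Σᵢ Πᵢ(ξ) = 1` on the ball. [cite: BrennerThomeeWahlbin1975, Ch. 5 §1, proof of Lemma 1.2] -/
theorem sum_proj {ξ : EuclideanSpace ℝ (Fin d)} (hξ : ξ ∈ E.dom) : ∑ i, E.proj i ξ = 1 := by
  rcases Nat.eq_zero_or_pos E.count with h0 | hpos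
  · -- no branches: `N = Σ mult = 0`, the matrix ring is trivial
    have hN : N = 0 := by
      have h := E.sum_mult
      have : (Finset.univ : Finset (Fin E.count)) = ∅ := by
        rw [Finset.univ_eq_empty_iff]
        rw [h0]; infer_instance
      rw [this, Finset.sum_empty] at h
      exact h.symm
    subst hN
    exact Subsingleton.elim _ _
  · haveI : Nonempty (Fin E.count) := ⟨⟨0, hpos⟩⟩
    exact sum_aeval_basis (pencil A ξ) (E.injOn_branch hξ) Finset.univ_nonempty

/-- A real polynomial vanishing at all branch values annihilates `A(ξ)` on the ball.
[folklore] -/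
theorem aeval_eq_zero_of_forall_branch {ξ : EuclideanSpace ℝ (Fin d)} (hξ : ξ ∈ E.dom) {q : ℝ[X]}
    (hq : ∀ b, q.eval (E.branch b ξ) = 0) : aeval (pencil A ξ) q = 0 := by
  refine aeval_eq_zero_of_forall_eval_eq_zero (isHermitian_pencil hA ξ) fun k => ?_
  obtain ⟨b, -, hb⟩ := E.exists_branch_eq_eigenvalues hξ k
  rw [hb]
  exact hq b

/-- `Πᵢ(ξ)Πⱼ(ξ) = 0` for `i ≠ j` on the ball (`LᵢLⱼ` vanishes at every node).
[cite: BrennerThomeeWahlbin1975, Ch. 5 §1, proof of Lemma 1.2] -/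
theorem proj_mul_proj_of_ne {ξ : EuclideanSpace ℝ (Fin d)} (hξ : ξ ∈ E.dom) {i j : Fin E.count}
    (hij : i ≠ j) : E.proj i ξ * E.proj j ξ = 0 := by
  unfold proj
  rw [← map_mul]
  refine E.aeval_eq_zero_of_forall_branch hξ fun b => ?_
  rw [eval_mul]
  by_cases hbi : b = i
  · subst hbi
    have h0 := Lagrange.eval_basis_of_ne (v := fun b => E.branch b ξ) (Ne.symm hij) (Finset.mem_univ b)
    rw [h0, mul_zero]
  · have h0 := Lagrange.eval_basis_of_ne (v := fun b => E.branch b ξ) (fun h => hbi h.symm)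
      (Finset.mem_univ b)
    rw [h0, zero_mul]

/-- `Πᵢ(ξ)² = Πᵢ(ξ)` on the ball (`Lᵢ² - Lᵢ` vanishes at every node). [folklore] -/
theorem proj_mul_self {ξ : EuclideanSpace ℝ (Fin d)} (hξ : ξ ∈ E.dom) (i : Fin E.count) :
    E.proj i ξ * E.proj i ξ = E.proj i ξ := by
  rw [← sub_eq_zero]
  unfold proj
  rw [← map_mul, ← map_sub]
  refine E.aeval_eq_zero_of_forall_branch hξ fun b => ?_
  rw [eval_sub, eval_mul]
  by_cases hbi : b = i
  · subst hbi
    have h0 := Lagrange.eval_basis_self (v := fun b => E.branch b ξ) (E.injOn_branch hξ)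
      (Finset.mem_univ b)
    rw [h0]; ring
  · have h0 := Lagrange.eval_basis_of_ne (v := fun b => E.branch b ξ) (fun h => hbi h.symm)
      (Finset.mem_univ b)
    rw [h0]; ring

/-- **The eigenprojections form a complete family of orthogonal idempotents** on the ball.
[cite: BrennerThomeeWahlbin1975, Ch. 5 §1, proof of Lemma 1.2] -/
theorem completeOrthogonalIdempotents_proj {ξ : EuclideanSpace ℝ (Fin d)} (hξ : ξ ∈ E.dom) :
    CompleteOrthogonalIdempotents (fun i => E.proj i ξ) where
  idem i := E.proj_mul_self hξ i
  ortho _ _ hij := E.proj_mul_proj_of_ne hξ hij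
  complete := E.sum_proj hξ

/-- **Spectral decomposition** `A(ξ) = Σᵢ zᵢ(ξ) Πᵢ(ξ)` on the ball.
[cite: BrennerThomeeWahlbin1975, Ch. 5 §1, proof of Lemma 1.2] -/
theorem pencil_eq_sum_smul_proj {ξ : EuclideanSpace ℝ (Fin d)} (hξ : ξ ∈ E.dom) :
    pencil A ξ = ∑ i, ((E.branch i ξ : ℝ) : ℂ) • E.proj i ξ := by
  calc pencil A ξ = pencil A ξ * ∑ i, E.proj i ξ := by rw [E.sum_proj hξ, mul_one]
    _ = ∑ i, ((E.branch i ξ : ℝ) : ℂ) • E.proj i ξ := by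
        rw [Finset.mul_sum]
        exact Finset.sum_congr rfl fun i _ => E.pencil_mul_proj hξ i

/-- `Πᵢ(ξ) ≠ 0` on the ball (the branch value is an eigenvalue). [folklore] -/
theorem proj_ne_zero {ξ : EuclideanSpace ℝ (Fin d)} (hξ : ξ ∈ E.dom) (i : Fin E.count) :
    E.proj i ξ ≠ 0 := by
  obtain ⟨k, hk⟩ := E.exists_eigenvalues_eq_branch hξ i
  exact aeval_basis_ne_zero (isHermitian_pencil hA ξ) (E.injOn_branch hξ)
    (E.exists_branch_eq_eigenvalues hξ) (Finset.mem_univ i) hk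

/-! ### Smoothness of the eigenprojections -/

/-- One Lagrange factor evaluated at a matrix:
`((x - y)⁻¹(X - y))(M) = (x - y)⁻¹ • (M - y • 1)` (real scalars acting on complex matrices).
[folklore] -/
theorem aeval_basisDivisor_real (M : Matrix (Fin N) (Fin N) ℂ) (x y : ℝ) :
    aeval M (Lagrange.basisDivisor x y) = (x - y)⁻¹ • (M - y • (1 : Matrix (Fin N) (Fin N) ℂ)) := by
  rw [Lagrange.basisDivisor, map_mul, aeval_C, map_sub, aeval_X, aeval_C,
    Algebra.algebraMap_eq_smul_one, Algebra.algebraMap_eq_smul_one, smul_mul_assoc, one_mul]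

/-- **The eigenprojection as an explicit product** of the factors
`(zᵢ(ξ) - z_b(ξ))⁻¹ (A(ξ) - z_b(ξ)I)`, `b ≠ i`. [folklore] -/
theorem proj_eq_list_prod (i : Fin E.count) (ξ : EuclideanSpace ℝ (Fin d)) :
    E.proj i ξ = ((Finset.univ.erase i).toList.map fun b =>
      (E.branch i ξ - E.branch b ξ)⁻¹ • (pencil A ξ - (E.branch b ξ) • (1 : Matrix (Fin N) (Fin N) ℂ))).prod := by
  unfold proj Lagrange.basis
  rw [← Finset.prod_map_toList, map_list_prod, List.map_map]
  congr 1
  refine List.map_congr_left fun b _ => ?_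
  exact aeval_basisDivisor_real (pencil A ξ) _ _

section Smooth

open scoped Matrix.Norms.Operator

/-- The pencil is a smooth (indeed linear) matrix-valued function of `ξ`. [folklore] -/
theorem contDiff_pencil (A : Fin d → Matrix (Fin N) (Fin N) ℂ) {n : WithTop ℕ∞} :
    ContDiff ℝ n (pencil A) := by
  unfold pencil
  refine ContDiff.sum fun j _ => ?_
  exact (Complex.ofRealCLM.contDiff.comp (EuclideanSpace.proj j).contDiff).smul
    (contDiff_const (c := A j))

/-- A product of a list of `C^n` matrix-valued functions is `C^n`. [folklore] -/
theorem contDiffOn_list_prod {n : WithTop ℕ∞} {s : Set (EuclideanSpace ℝ (Fin d))}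
    (l : List (EuclideanSpace ℝ (Fin d) → Matrix (Fin N) (Fin N) ℂ))
    (h : ∀ f ∈ l, ContDiffOn ℝ n f s) :
    ContDiffOn ℝ n (fun ξ => (l.map fun f => f ξ).prod) s := by
  induction l with
  | nil => simpa using contDiffOn_const
  | cons f l ih =>
      have hf : ContDiffOn ℝ n f s := h f (by simp)
      have hl : ContDiffOn ℝ n (fun ξ => (l.map fun g => g ξ).prod) s :=
        ih fun g hg => h g (by simp [hg])
      simpa [List.map_cons, List.prod_cons] using hf.mul hl

/-- One factor `(zᵢ - z_b)⁻¹ • (A(ξ) - z_b I)` is `C^∞` on the ball (`b ≠ i`). [folklore] -/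
theorem contDiffOn_factor {i b : Fin E.count} (hb : b ≠ i) :
    ContDiffOn ℝ ∞ (fun ξ => (E.branch i ξ - E.branch b ξ)⁻¹ •
      (pencil A ξ - (E.branch b ξ) • (1 : Matrix (Fin N) (Fin N) ℂ))) E.dom := by
  have h1 : ContDiffOn ℝ ∞ (fun ξ => (E.branch i ξ - E.branch b ξ)⁻¹) E.dom := by
    refine ((E.contDiffOn_infty i).sub (E.contDiffOn_infty b)).inv fun ξ hξ => ?_
    exact sub_ne_zero.2 (E.branch_ne hξ (Ne.symm hb))
  have h2 : ContDiffOn ℝ ∞ (fun ξ => pencil A ξ - (E.branch b ξ) • (1 : Matrix (Fin N) (Fin N) ℂ))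
      E.dom := by
    refine (contDiff_pencil A).contDiffOn.sub ?_
    exact (E.contDiffOn_infty b).smul (contDiffOn_const (c := (1 : Matrix (Fin N) (Fin N) ℂ)))
  exact h1.smul h2

/-- The eigenprojection is `C^∞` on the ball as a matrix-valued function. [folklore] -/
theorem contDiffOn_proj (i : Fin E.count) : ContDiffOn ℝ ∞ (E.proj i) E.dom := by
  set l : List (EuclideanSpace ℝ (Fin d) → Matrix (Fin N) (Fin N) ℂ) :=
    (Finset.univ.erase i).toList.map fun b ξ =>
      (E.branch i ξ - E.branch b ξ)⁻¹ • (pencil A ξ - (E.branch b ξ) • (1 : Matrix (Fin N) (Fin N) ℂ))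
    with hl
  have heq : E.proj i = fun ξ => (l.map fun f => f ξ).prod := by
    funext ξ
    rw [E.proj_eq_list_prod i ξ, hl, List.map_map]
    rfl
  rw [heq]
  refine contDiffOn_list_prod l fun f hf => ?_
  rw [hl, List.mem_map] at hf
  obtain ⟨b, hb, rfl⟩ := hf
  rw [Finset.mem_toList, Finset.mem_erase] at hb
  exact E.contDiffOn_factor hb.1

/-- **The entries of the eigenprojections are `C^∞` on the ball.**
[cite: BrennerThomeeWahlbin1975, Ch. 5 §1, proof of Lemma 1.1 (first sentence)] -/
theorem contDiffOn_proj_apply (i : Fin E.count) (a b : Fin N) :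
    ContDiffOn ℝ ∞ (fun ξ => E.proj i ξ a b) E.dom := by
  set L : Matrix (Fin N) (Fin N) ℂ →L[ℝ] ℂ :=
    LinearMap.toContinuousLinearMap (Matrix.entryLinearMap ℝ ℂ a b) with hL
  have h := L.contDiff.comp_contDiffOn (E.contDiffOn_proj i)
  exact h

end Smooth

end EigenBranches

end Literature.Analysis.Matrix

end
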